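import Summits.BirchSwinnertonDyer.BirchSwinnertonDyer.Theses.AdditiveKolyvaginRoad
import Summits.BirchSwinnertonDyer.Rank1Residual.X11b.BDPRouteOnTreeStepL
import Literature.NumberTheory.EllipticCurves.HeegnerPointsClassesProofs
import Literature.NumberTheory.EllipticCurves.HeegnerPointsRationalityProofs
import Literature.NumberTheory.EllipticCurves.HeegnerPointsImaginaryQuadraticProofs
import Literature.NumberTheory.EllipticCurves.BSDSelmerCMPConverseHeegnerFieldProofs
import Literature.NumberTheory.EllipticCurves.BSDRankZeroDensityProofs
import Literature.NumberTheory.EllipticCurves.IwasawaLeadingTermProofs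
import Literature.NumberTheory.EllipticCurves.SelmerCorankHolds
import Literature.NumberTheory.EllipticCurves.NonEisensteinPrimeOfSurjective
import HarnessLib

/-!
# Route `AdditiveKolyvaginRoad`, crux `KolyvaginPrimitiveAdditive` (item stmt-BirchSwinnertonDyer-20132):
# the p-PARITY of `Sel_p(E/K)` at a ♯ additive Hoffstein–Luo frame, FROM PUBLISHED INPUTS
# (cell `pub/bsd-wall`, lead prover `bsd-wall-akr-p1`; `--supports stmt-BirchSwinnertonDyer-20132`, helper)

W. Zhang's induction on the `p`-Selmer rank (Camb. J. Math. 2 (2014) §9, Thm 9.1 with Thm 9.2) — the idea of the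
birth line of crux 20132 — splits the ♯ additive frames by `dim_𝔽_p Sel_p(E/K)`: the bottom `dim = 1` (Zhang Thm 7.2:
one level raising, the rank-zero anchor, the first reciprocity law — stubs S/A/B of the registered skeleton v2) and
the induction above the bottom (`dim ≥ 3`). That the dimension is ODD — so that «`#Sel_p(E/K) ≠ p`» means «`dim ≥ 3`»
and not `dim ∈ {0, 2, …}` — is NOT part of Kolyvagin's conjecture: on a Hoffstein–Luo frame (`r_an(E) = 1`,
`L(E^{d_K}, 1) ≠ 0`) it follows from PUBLISHED theorems only, exactly as at `p = 3` (crux 19574, stub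
`Method2.stub_oddSelmerRankAtThree`, koly g12 `Theorems/KolyvaginRoadThreeMethod2OddSelmerRank.lean`, of which this file
is the `p`-generic clone):

* `gross_zagier` (Gross–Zagier 1986) and `hasEntireLFunction_rat` (modularity): the Heegner point `y_K` is non-torsion
  — tree theorem `X11b.not_isOfFinAddOrder_of_heegner_of_analyticRank_eq_one`;
* `kolyvagin` (Kolyvagin 1990: `y_K` non-torsion ⇒ `rank E(K) = 1` and `Ш(E/K)` finite);
* `WeierstrassCurve.exists_casselsTate_pairing` (Cassels–Tate: `dim_𝔽_p Ш(E/K)[p]` even) — through the tree theorem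
  `exists_selmerRank_eq_add`: `#Sel_p = p^s`, `#E(K)[p] = p^t` ⇒ `s = t + corank_p + 2m`;
and the tree THEOREMS `selmerCorank_eq_mordellWeilRank_add_holds`, `finite_primaryComponent_sha_iff_shaCorank_eq_zero`,
`torsionBy_eq_bot_of_isImaginaryQuadratic_of_hasIrreducibleModPGaloisRep` (`E(K)[p] = 0` from `ρ̄_{E,p}` onto ⇒
irreducible, `hasIrreducibleModPGaloisRep_of_hasSurjectiveModNGaloisRep`). So `s = 0 + 1 + 2m` is odd.

THEOREMS (no definition, no named fact asserted, no `sorry`):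
* `odd_selmerRank_of_rankOne_of_finiteSha_prime` — any number field, any prime `p`: rank one + `Ш` finite + no
  `p`-torsion + Cassels–Tate ⇒ `#Sel_p = p^s` with `s` odd;
* `oddSelmerRankAdditive_of_published` — at every frame of the crux `KolyvaginPrimitiveAdditive` (its binders
  VERBATIM; only `r_an = 1`, `ρ̄` onto, `K`, the Heegner hypothesis, `L(E^{d_K},1) ≠ 0` and the orientation are used):
  `∃ s, Odd s ∧ #Sel_p(E/K) = p^s` — the text of the parity stub `stub_oddSelmerRankAdditive` of the lead's reshaped
  skeleton v3, CONDITIONAL on the four named facts (all published). Nothing about Kolyvagin's conjecture is asserted;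
  nothing is booked (W-ALL row 2: types-the-object-of; closes: none).

References: [cite: WZhang2014, Thm. 9.2 (parity) and §9 proof of Thm. 9.1] [cite: GrossLMS1991, §10 (Prop. 2.3)]
[cite: SilvermanAEC2009, Thm. X.4.14 (Cassels–Tate)].
-/

-- single-conjunct summit: `Summit.BirchSwinnertonDyer.BirchSwinnertonDyer.…` repeats the name by design
set_option linter.dupNamespace false

noncomputable section

open scoped Classical

namespace Summit.BirchSwinnertonDyer.BirchSwinnertonDyer.Theorems.AdditiveKoly

open WeierstrassCurve NumberField IsDedekindDomain Literature.NumberTheory.EllipticCurves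
  Literature.NumberTheory.EllipticCurves.ModularForms
  Literature.NumberTheory.EllipticCurves.Rank1Residual
  Summit.BirchSwinnertonDyer.Rank1Residual Summit.BirchSwinnertonDyer.Rank1Residual.X11b

/-! ## Rank one + `Ш` finite + no `p`-torsion ⇒ odd `p`-Selmer rank (any number field, any prime) -/

/-- **Odd `p`-Selmer rank from rank one.** For an elliptic curve `E` over a number field `F` with `rank E(F) = 1`,
`Ш(E/F)` finite and `E(F)[p] = 0`, granting the Cassels–Tate pairing, `#Sel_p(E/F) = p^s` with `s` ODD:
`s = t + corank_p + 2m` (tree `exists_selmerRank_eq_add`) with `t = 0`, `corank_p = rank + corank Ш[p^∞] = 1 + 0`.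
(`p`-generic clone of koly g12's `Method2.odd_selmerRank_of_rankOne_of_finiteSha`.)
[cite: SilvermanAEC2009, Thm. X.4.14] [cite: WZhang2014, Thm. 9.2] -/
theorem odd_selmerRank_of_rankOne_of_finiteSha_prime {F : Type} [Field F] [NumberField F]
    (E : WeierstrassCurve F) [E.IsElliptic] (p : ℕ) [Fact p.Prime]
    (hCT : exists_casselsTate_pairing (K := F)) (hrank : E.mordellWeilRank = 1)
    (hSha : Finite E.sha) (htors : AddSubgroup.torsionBy E.toAffine.Point ((p : ℕ) : ℤ) = ⊥) :
    ∃ s : ℕ, Odd s ∧ Nat.card (E.selmerGroup ((p : ℕ) : ℤ)) = p ^ s := by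
  obtain ⟨s, hs⟩ := exists_natCard_selmerGroup_eq_pow E p
  have ht : Nat.card (AddSubgroup.torsionBy E.toAffine.Point ((p : ℕ) : ℤ)) = p ^ 0 := by
    rw [htors, pow_zero, AddSubgroup.card_bot]
  obtain ⟨m, hm⟩ := exists_selmerRank_eq_add hCT E p s 0 hs ht
  have hsha0 : E.shaCorank p = 0 := by
    rw [← finite_primaryComponent_sha_iff_shaCorank_eq_zero E p]
    haveI := hSha
    infer_instance
  have hcorank : E.selmerCorank p = 1 := by
    rw [E.selmerCorank_eq_mordellWeilRank_add_holds p, hrank, hsha0]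
  refine ⟨s, ⟨m, ?_⟩, hs⟩
  rw [hm, hcorank]
  ring

/-! ## The parity stub from published inputs -/

/-- **The p-PARITY of `Sel_p(E/K)` at every frame of `KolyvaginPrimitiveAdditive`, FROM PUBLISHED INPUTS** — the
text of the lead's stub `stub_oddSelmerRankAdditive` (skeleton v3 of crux 20132) as conclusion. At a ♯ additive
Hoffstein–Luo frame (`p ≥ 5` additive for `E`, `ρ̄_{E,p}` onto, `r_an(E) = 1`, `K` imaginary quadratic Heegner for
`N_E` with `L(E^{d_K}, 1) ≠ 0`, orientation `β`): the Heegner point `y_K` is non-torsion (Gross–Zagier + modularity),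
so `rank E(K) = 1` and `Ш(E/K)` is finite (Kolyvagin), `E(K)[p] = 0` (`ρ̄` onto ⇒ irreducible, over the quadratic
field `K`), and Cassels–Tate makes `dim_𝔽_p Ш(E/K)[p]` even; hence `#Sel_p(E/K) = p^s` with `s` odd. CONDITIONAL on
the four named facts (all published); the additive hypotheses, ♠, the Tamagawa and Manin binders are idle here (kept
so that the statement is the stub's text verbatim). [cite: WZhang2014, Thm. 9.2]
[cite: GrossLMS1991, §10 (Prop. 2.3)] [cite: SilvermanAEC2009, Thm. X.4.14] -/
theorem oddSelmerRankAdditive_of_published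
    (hGZ : ∀ (N : ℕ) [NeZero N] (W : WeierstrassCurve ℚ) (K : Type) [Field K] [NumberField K], gross_zagier N W K)
    (hKo : ∀ (N : ℕ) [NeZero N] (W : WeierstrassCurve ℚ) (K : Type) [Field K] [NumberField K], kolyvagin N W K)
    (hmod : hasEntireLFunction_rat)
    (hCT : ∀ (F : Type) [Field F] [NumberField F], exists_casselsTate_pairing (K := F)) :
    ∀ (W : WeierstrassCurve ℚ) [W.IsElliptic] [W.IsGloballyMinimal] [NeZero (W.conductorNorm ℤ)]
      (p : ℕ) [Fact p.Prime] (K : Type) [Field K] [NumberField K]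
      (Dt : ModularParametrizationData W (W.conductorNorm ℤ)) (β : ℤ) (ι : K →+* ℂ),
      5 ≤ p → Addv W p → W.HasSurjectiveModNGaloisRep p →
      (∀ (ℓ : ℕ) [Fact ℓ.Prime], W.HasMultiplicativeReductionAtPrime ℓ →
        ¬ p ∣ padicValInt ℓ W.minimalDiscriminantInt) →
      (∃ (ℓ₁ ℓ₂ : ℕ) (_ : Fact ℓ₁.Prime) (_ : Fact ℓ₂.Prime), ℓ₁ ≠ ℓ₂ ∧
        W.HasMultiplicativeReductionAtPrime ℓ₁ ∧ W.HasMultiplicativeReductionAtPrime ℓ₂) →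
      ¬ p ∣ W.tamagawaProduct → W.analyticRank = 1 →
      IsImaginaryQuadratic K → Odd (NumberField.discr K) →
      SatisfiesHeegnerHypothesis (W.conductorNorm ℤ) K →
      (W.quadraticTwist (NumberField.discr K : ℚ)).entireLFunction 1 ≠ 0 →
      (4 * (W.conductorNorm ℤ : ℤ)) ∣ β ^ 2 - NumberField.discr K → ¬ (p : ℤ) ∣ Dt.c →
      ∃ s : ℕ, Odd s ∧ Nat.card (WeierstrassCurve.selmerGroup (W.baseChange K) (p : ℤ)) = p ^ s := by
  intro W _ _ _ p _ K _ _ Dt β ι _h5 _hadd hsurj _hsp1 _hsp2 _htam hr1 hK _hodd hH hLt hβ _hc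
  -- `E[p]` irreducible (ρ̄ onto), hence `E(K)[p] = 0` over the quadratic field `K`
  have hirr : W.HasIrreducibleModPGaloisRep p := hasIrreducibleModPGaloisRep_of_hasSurjectiveModNGaloisRep W p hsurj
  have hbot := torsionBy_eq_bot_of_isImaginaryQuadratic_of_hasIrreducibleModPGaloisRep W K hK (Fact.out : p.Prime)
    hirr
  -- THE Heegner point `P = y_K ∈ E(K)` of the frame, non-torsion by Gross–Zagier
  have hDneg : NumberField.discr K < 0 := hK.discr_neg
  obtain ⟨H, -⟩ := exists_heegnerDatum (W.conductorNorm ℤ) hDneg hβ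
  obtain ⟨P, hP⟩ := heegnerPointComplex_mem_range_map_holds (W.conductorNorm ℤ) W K hK hH Dt H ι
  have hPinf : ¬ IsOfFinAddOrder P :=
    not_isOfFinAddOrder_of_heegner_of_analyticRank_eq_one W (W.conductorNorm ℤ) K Dt H ι P (hGZ _ W K) hmod hr1 hK
      hH hLt hP
  -- Kolyvagin: rank one and `Ш(E/K)` finite
  obtain ⟨hrank, hSha⟩ := hKo _ W K hK hH ⟨Dt, H, ι, hP⟩ hPinf
  exact odd_selmerRank_of_rankOne_of_finiteSha_prime (W.baseChange K) p (hCT K) hrank hSha hbot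

end Summit.BirchSwinnertonDyer.BirchSwinnertonDyer.Theorems.AdditiveKoly

end
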